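import Literature.Analysis.FluidPDE.OnsagerBDSVGluingProofs
import Literature.Analysis.FluidPDE.OnsagerBDSVCutoffs
import Literature.Analysis.FluidPDE.Antidivergence
import Literature.Analysis.FluidPDE.NavierStokesConcentrationTools
import HarnessLib

/-!
# The BDSV gluing stage: the glued triple `(v̄_q, p̄_q, R̊̄_q)` of §4.1–4.2 and its Euler–Reynolds
# system

Buckmaster–De Lellis–Székelyhidi–Vicol, *Onsager's conjecture for admissible weak solutions*,
CPAM 72 (2019) = arXiv:1701.08678, §4.1–4.2: given the exact solutions `vᵢ` on
`|t - tᵢ| ≤ τ_q` (`tᵢ = iτ_q`) and the partition of unity `χᵢ` in time, set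
`v̄_q = ∑ χᵢvᵢ`, `p̄_q⁽¹⁾ = ∑ χᵢpᵢ` and, on `Iᵢ`,
`R̊̄_q = ∂ₜχᵢ ℛ(vᵢ - vᵢ₊₁) - χᵢ(1-χᵢ)(vᵢ - vᵢ₊₁) ⊗̊ (vᵢ - vᵢ₊₁)`, `p̄_q = p̄⁽¹⁾ + p̄⁽²⁾`; then
"`R̊̄_q` is a smooth symmetric and traceless 2-tensor", the triple solves the Euler–Reynolds system
and `supp R̊̄_q ⊂ T³ × ⋃ Iᵢ` (the three bullets of §4.2, using Prop. 4.1: `div ℛf = f` for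
mean-free `f`). This file carries this out for the cut-offs of `OnsagerBDSVCutoffs.lean`
(`χ_k = BDSV.glueCutoff τ n k`, generated by the steps `θ_k = BDSV.upperStep τ n k`, the last two
cut-offs merged so that only anchors `t_k ≤ T` occur, `n = ⌊T/τ⌋`) and any anchored family
`(vᵢ, pᵢ)` of exact solutions (`BDSV.IsGlueFamily`, the hypotheses of `BDSV.gluedTripleEstimates`
minus the estimates):

* `BDSV.gluedVel`, `BDSV.gluedPres`, `BDSV.gluedStress` — the glued triple, written globally as
  `v̄ = ∑_{k ≤ n} χ_k v_k`, `R̊̄ = ∑_{k < n} (θ_k' ℛw_k - θ_k(1-θ_k) w_k ⊗̊ w_k)`, `w_k = v_k - v_{k+1}`,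
  `p̄ = ∑_{k ≤ n} χ_k p_k + ∑_{k < n} θ_k(1-θ_k)(|w_k|²/3 - ⨍|w_k|²/3)`;
* `BDSV.IsGlueFamily.isEulerReynoldsOn_glued` — **the glued triple is an Euler–Reynolds triple on
  `[0,T] × T³`**: joint smoothness by the temporal cut-off gluing lemmas of
  `NavierStokesConcentrationTools` (`Torus.IsTimeCutoff`), the momentum equation at a time of
  `[t_i, t_i + τ]` by collapsing all sums to the two active indices `i, i+1` and the algebra of
  §4.1 (tactic `module`), with `div ℛw_i = w_i` from `Torus.tensorDivergence_antidivergence` and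
  the **conservation of momentum** of Euler–Reynolds triples
  (`Torus.IsEulerReynoldsOn.integral_velocity_eq`, whence `∫ w_i = 0`), and
  `div (w ⊗̊ w) = (w·∇)w - ∇|w|²/3` (`Torus.tensorDivergence_tracelessSq`);
* `BDSV.IsGlueFamily.supportedOnGlueIntervals_gluedStress` — (2.17);
* the local formulas `BDSV.IsGlueFamily.gluedVel_apply` (`v̄ = θᵢvᵢ + (1-θᵢ)vᵢ₊₁` on
  `[tᵢ, tᵢ₊₁]`), `gluedStress_apply`, `gluedPres_apply`, `gluedVel_sub_eq_sum`
  (`v̄ - v_ℓ = ∑ χ_k(v_k - v_ℓ)`), consumed by the estimates of Props. 4.2–4.4.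

The printed `p̄⁽²⁾ = -χᵢ(1-χᵢ)|vᵢ - vᵢ₊₁|²` is a misprint: with the paper's conventions
(`∂ₜv + div(v ⊗ v) + ∇p = div R̊`, `f ⊗̊ g` the traceless part) the momentum balance forces
`p̄⁽²⁾ = +χᵢ(1-χᵢ)|vᵢ - vᵢ₊₁|²/3` (up to a function of time, fixed by `∫ p̄ = 0`), which is what is
used here; the pressure plays no role in (2.18)–(2.22).

## References

* T. Buckmaster, C. De Lellis, L. Székelyhidi Jr., V. Vicol, *Onsager's conjecture for admissible
  weak solutions*, Comm. Pure Appl. Math. 72 (2019) 229–274 = arXiv:1701.08678, §4.1 (partition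
  of unity, `v̄_q`), §4.2 (Prop. 4.1, `R̊̄_q`, `p̄_q`, the three bullets), (2.17).
* C. De Lellis, L. Székelyhidi Jr., *Dissipative continuous Euler flows*, Invent. Math. 193
  (2013), §4 (the operator `ℛ`).
-/

noncomputable section

open MeasureTheory Set Filter Topology Function
open scoped ContDiff

namespace Literature.Analysis.FluidPDE

/-! ## Conservation of momentum for Euler–Reynolds triples -/

namespace Torus

open FunctionSpaces FunctionSpaces.Torus

variable {d : Type*} [Fintype d] [DecidableEq d]

/-- The space integral of the tensor divergence of a smooth tensor field vanishes. [folklore] -/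
theorem integral_tensorDivergence {S : UnitAddTorus d → d → EuclideanSpace ℝ d} (hS : FunctionSpaces.Torus.IsSmooth S) :
    ∫ x, tensorDivergence S x = 0 := by
  unfold tensorDivergence
  rw [integral_finsetSum _ fun j _ => ((hS.column j).partialDeriv j).integrable]
  exact Finset.sum_eq_zero fun j _ => integral_partialDeriv_eq_zero_holds (hS.column j) j

/-- **Euler–Reynolds triples conserve momentum**: `∫ v(s) = ∫ v(t)` for all `s, t ∈ [a,b]`
(`d/dt ∫ v = ∫ (div R̊ - ∇p - (v·∇)v) = 0`: each term integrates to zero on the torus, the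
convective one because `div v = 0`). [folklore] -/
theorem IsEulerReynoldsOn.integral_velocity_eq {a b : ℝ} {v : ℝ → UnitAddTorus d → EuclideanSpace ℝ d}
    {p : ℝ → UnitAddTorus d → ℝ} {R : ℝ → UnitAddTorus d → d → EuclideanSpace ℝ d}
    (h : IsEulerReynoldsOn (Icc a b) v p R) {s t : ℝ} (hs : s ∈ Icc a b) (ht : t ∈ Icc a b) :
    ∫ x, v s x = ∫ x, v t x := by
  rcases lt_or_ge a b with hab | hab
  · set E : ℝ → EuclideanSpace ℝ d := fun τ => ∫ x, v τ x with hE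
    have hU : UniqueDiffOn ℝ (Icc a b) := uniqueDiffOn_Icc hab
    have hderiv : ∀ τ ∈ Icc a b, HasDerivWithinAt E (0 : EuclideanSpace ℝ d) (Icc a b) τ := by
      intro τ hτ
      have h1 := h.smooth_velocity.hasDerivWithinAt_integral (convex_Icc a b) hτ
      have hvs : FunctionSpaces.Torus.IsSmooth (v τ) := h.smooth_velocity.isSmooth_slice hτ
      have hps : FunctionSpaces.Torus.IsSmooth (p τ) := h.smooth_pressure.isSmooth_slice hτ
      have hRs : FunctionSpaces.Torus.IsSmooth (R τ) := h.smooth_stress.isSmooth_slice hτ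
      have h0 : ∫ x, FunctionSpaces.Torus.timeDerivWithin (Icc a b) v τ x = 0 := by
        have e : ∀ x, FunctionSpaces.Torus.timeDerivWithin (Icc a b) v τ x =
            tensorDivergence (R τ) x - FunctionSpaces.Torus.gradient (p τ) x - FunctionSpaces.Torus.convect (v τ) (v τ) x := by
          intro x
          rw [← h.momentum τ hτ x]
          abel
        simp_rw [e]
        have i1 : Integrable (fun x => tensorDivergence (R τ) x) volume := hRs.tensorDivergence.integrable
        have i2 : Integrable (fun x => FunctionSpaces.Torus.gradient (p τ) x) volume := hps.gradient.integrable
        have i3 : Integrable (fun x => FunctionSpaces.Torus.convect (v τ) (v τ) x) volume := (hvs.convect hvs).integrable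
        have i12 : Integrable (fun x => tensorDivergence (R τ) x - FunctionSpaces.Torus.gradient (p τ) x) volume := i1.sub i2
        have hc : ∫ x, FunctionSpaces.Torus.convect (v τ) (v τ) x = 0 :=
          integral_fderiv_apply_eq_zero_of_isDivFree hvs hvs (h.divFree τ hτ)
        calc ∫ x, (tensorDivergence (R τ) x - FunctionSpaces.Torus.gradient (p τ) x - FunctionSpaces.Torus.convect (v τ) (v τ) x)
            = (∫ x, (tensorDivergence (R τ) x - FunctionSpaces.Torus.gradient (p τ) x)) -
                ∫ x, FunctionSpaces.Torus.convect (v τ) (v τ) x := integral_sub i12 i3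
          _ = ((∫ x, tensorDivergence (R τ) x) - ∫ x, FunctionSpaces.Torus.gradient (p τ) x) -
                ∫ x, FunctionSpaces.Torus.convect (v τ) (v τ) x := by rw [integral_sub i1 i2]
          _ = 0 := by rw [integral_tensorDivergence hRs, integral_gradient_eq_zero hps, hc]; simp
      rw [h0] at h1
      exact h1
    have hdiff : DifferentiableOn ℝ E (Icc a b) := fun τ hτ => (hderiv τ hτ).differentiableWithinAt
    have hconst := constant_of_derivWithin_zero hdiff fun τ hτ =>
      (hderiv τ (Ico_subset_Icc_self hτ)).derivWithin (hU τ (Ico_subset_Icc_self hτ))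
    rw [show (∫ x, v s x) = E s from rfl, show (∫ x, v t x) = E t from rfl, hconst s hs, hconst t ht]
  · have hs' : s = a := le_antisymm (hs.2.trans hab) hs.1
    have ht' : t = a := le_antisymm (ht.2.trans hab) ht.1
    rw [hs', ht']

end Torus

namespace BDSV

open FunctionSpaces FunctionSpaces.Torus

/-- The flat three-torus `T³ = (ℝ/ℤ)³`, local notation. -/
local notation "𝕋³" => UnitAddTorus (Fin 3)

/-- Euclidean `ℝ³`, local notation. -/
local notation "ℝ³" => EuclideanSpace ℝ (Fin 3)

/-! ## The glued triple -/

section Definitions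

/-- The velocity differences `w_k = v_k - v_{k+1}` of consecutive exact solutions. [cite: BuckmasterEtAl2018, §4.1] -/
def velDiff (v : ℕ → ℝ → 𝕋³ → ℝ³) (k : ℕ) : ℝ → 𝕋³ → ℝ³ :=
  fun t x => v k t x - v (k + 1) t x

/-- The density `|w|²/3` whose mean-free part enters the glued pressure. [folklore] -/
def sqThird (w : ℝ → 𝕋³ → ℝ³) : ℝ → 𝕋³ → ℝ :=
  fun t x => ‖w t x‖ ^ 2 / Fintype.card (Fin 3)

/-- The derivative `θ_k'` of the `k`-th upper step (`0` for `k ≥ n`). [cite: BuckmasterEtAl2018, §4.2] -/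
def stepDeriv (τ : ℝ) (n k : ℕ) : ℝ → ℝ :=
  deriv (upperStep τ n k)

/-- The transition weight `θ_k(1 - θ_k)` of the `k`-th upper step (`0` for `k ≥ n`). [cite: BuckmasterEtAl2018, §4.2] -/
def stepWeight (τ : ℝ) (n k : ℕ) : ℝ → ℝ :=
  fun t => upperStep τ n k t * (1 - upperStep τ n k t)

/-- **The glued velocity** `v̄ = ∑_{k ≤ n} χ_k v_k` (BDSV §4.1: "`v̄_q := ∑ᵢ χᵢvᵢ`"). [cite: BuckmasterEtAl2018, §4.1] -/
def gluedVel (τ : ℝ) (n : ℕ) (v : ℕ → ℝ → 𝕋³ → ℝ³) : ℝ → 𝕋³ → ℝ³ :=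
  fun t x => ∑ k ∈ Finset.range (n + 1), glueCutoff τ n k t • v k t x

/-- **The glued Reynolds stress** `R̊̄ = ∑_{k < n} (θ_k' ℛ(w_k) - θ_k(1-θ_k) w_k ⊗̊ w_k)`,
`w_k = v_k - v_{k+1}`, stored by columns; on `I_k` this is BDSV's
`∂ₜχ_k ℛ(v_k - v_{k+1}) - χ_k(1-χ_k)(v_k - v_{k+1}) ⊗̊ (v_k - v_{k+1})` and it vanishes off `⋃ I_k`
(BDSV §4.2; `ℛ` = `Torus.antidivergence`, `⊗̊` = `Torus.tracelessSq`). [cite: BuckmasterEtAl2018, §4.2] -/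
def gluedStress (τ : ℝ) (n : ℕ) (v : ℕ → ℝ → 𝕋³ → ℝ³) : ℝ → 𝕋³ → Fin 3 → ℝ³ :=
  fun t x j => ∑ k ∈ Finset.range n,
    (stepDeriv τ n k t • Torus.antidivergence (velDiff v k t) x j -
      stepWeight τ n k t • Torus.tracelessSq (velDiff v k t) x j)

/-- **The glued pressure** `p̄ = ∑_{k ≤ n} χ_k p_k + ∑_{k < n} θ_k(1-θ_k)(|w_k|²/3 - ⨍|w_k|²/3)`
(BDSV §4.2: `p̄ = p̄⁽¹⁾ + p̄⁽²⁾`, `p̄⁽¹⁾ = ∑χᵢpᵢ`; the printed `p̄⁽²⁾ = -χᵢ(1-χᵢ)|vᵢ - vᵢ₊₁|²` is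
corrected to the value forced by the momentum balance and normalised to zero mean). [cite: BuckmasterEtAl2018, §4.2] -/
def gluedPres (τ : ℝ) (n : ℕ) (v : ℕ → ℝ → 𝕋³ → ℝ³) (p : ℕ → ℝ → 𝕋³ → ℝ) : ℝ → 𝕋³ → ℝ :=
  fun t x => (∑ k ∈ Finset.range (n + 1), glueCutoff τ n k t * p k t x) +
    ∑ k ∈ Finset.range n, stepWeight τ n k t * (sqThird (velDiff v k) t x - ∫ y, sqThird (velDiff v k) t y)

end Definitions

/-! ## The hypotheses: an anchored family of exact solutions -/

section Family

/-- **The data glued in §4**: a final time `T > 0`, a scale `τ > 0` with `nτ ≤ T < (n+1)τ`, an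
Euler–Reynolds triple `(v_ℓ, p_ℓ, R̊_ℓ)` on `[0,T]`, and for every anchor `t_i = iτ ≤ T` a smooth
exact Euler solution `(v_i, p_i)` on `S_i = [t_i - τ, t_i + τ] ∩ [0,T]` with `v_i(t_i) = v_ℓ(t_i)`
(BDSV §3.1 (3.1) and §4.1; exactly the family of `BDSV.gluedTripleEstimates`, without its
estimates). [cite: BuckmasterEtAl2018, §3.1 (3.1) and §4.1] -/
structure IsGlueFamily (T τ : ℝ) (n : ℕ) (vℓ : ℝ → 𝕋³ → ℝ³) (pℓ : ℝ → 𝕋³ → ℝ)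
    (Rℓ : ℝ → 𝕋³ → Fin 3 → ℝ³) (v : ℕ → ℝ → 𝕋³ → ℝ³) (p : ℕ → ℝ → 𝕋³ → ℝ) : Prop where
  /-- Positive final time. -/
  hT : 0 < T
  /-- Positive scale. -/
  hτ : 0 < τ
  /-- `n = ⌊T/τ⌋`: `nτ ≤ T`. -/
  hn : (n : ℝ) * τ ≤ T
  /-- `n = ⌊T/τ⌋`: `T < (n+1)τ`. -/
  hn' : T < ((n : ℝ) + 1) * τ
  /-- The mollified Euler–Reynolds triple on `[0,T]`. -/
  er : Torus.IsEulerReynoldsOn (Icc 0 T) vℓ pℓ Rℓ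
  /-- The exact solutions on their life spans. -/
  exact : ∀ i : ℕ, (i : ℝ) * τ ≤ T → IsExactEulerOn (glueInterval T τ i) (v i) (p i)
  /-- The anchoring `v_i(t_i) = v_ℓ(t_i)`. -/
  anchor : ∀ i : ℕ, (i : ℝ) * τ ≤ T → v i ((i : ℝ) * τ) = vℓ ((i : ℝ) * τ)

variable {T τ : ℝ} {n : ℕ} {vℓ : ℝ → 𝕋³ → ℝ³} {pℓ : ℝ → 𝕋³ → ℝ} {Rℓ : ℝ → 𝕋³ → Fin 3 → ℝ³}
  {v : ℕ → ℝ → 𝕋³ → ℝ³} {p : ℕ → ℝ → 𝕋³ → ℝ}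
  (h : IsGlueFamily T τ n vℓ pℓ Rℓ v p)
include h

/-- Anchors up to `n` lie in `[0,T]`. [folklore] -/
theorem IsGlueFamily.anchor_le {i : ℕ} (hi : i ≤ n) : (i : ℝ) * τ ≤ T :=
  le_trans (mul_le_mul_of_nonneg_right (Nat.cast_le.2 hi) h.hτ.le) h.hn

/-- For `i < n`, `t_i + τ ≤ T`. [folklore] -/
theorem IsGlueFamily.anchor_add_le {i : ℕ} (hi : i < n) : (i : ℝ) * τ + τ ≤ T := by
  have := h.anchor_le (Nat.succ_le_of_lt hi)
  push_cast at this
  linarith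

/-- `[t_i, t_i + τ] ∩ [0,T] ⊆ S_i`. [folklore] -/
theorem IsGlueFamily.Icc_inter_subset_glueInterval (i : ℕ) :
    Icc ((i : ℝ) * τ) ((i : ℝ) * τ + τ) ∩ Icc 0 T ⊆ glueInterval T τ i := by
  intro t ht
  exact ⟨⟨by linarith [ht.1.1, h.hτ], ht.1.2⟩, ht.2⟩

/-- `[t_i, t_i + τ] ∩ [0,T] ⊆ S_{i+1}`. [folklore] -/
theorem IsGlueFamily.Icc_inter_subset_glueInterval_succ (i : ℕ) :
    Icc ((i : ℝ) * τ) ((i : ℝ) * τ + τ) ∩ Icc 0 T ⊆ glueInterval T τ (i + 1) := by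
  intro t ht
  refine ⟨⟨?_, ?_⟩, ht.2⟩
  · push_cast; linarith [ht.1.1]
  · push_cast; linarith [ht.1.2, h.hτ]

/-- Every `t ∈ [0,T]` lies in `[t_i, t_i + τ]` for some `i ≤ n` (`i = ⌊t/τ⌋`). [folklore] -/
theorem IsGlueFamily.exists_anchor {t : ℝ} (ht : t ∈ Icc 0 T) :
    ∃ i : ℕ, i ≤ n ∧ t ∈ Icc ((i : ℝ) * τ) ((i : ℝ) * τ + τ) := by
  have hτ := h.hτ
  refine ⟨⌊t / τ⌋₊, ?_, ?_, ?_⟩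
  · have h1 : (⌊t / τ⌋₊ : ℝ) ≤ t / τ := Nat.floor_le (div_nonneg ht.1 hτ.le)
    have h2 : t / τ < (n : ℝ) + 1 := by
      rw [div_lt_iff₀ hτ]; linarith [ht.2, h.hn']
    have h3 : (⌊t / τ⌋₊ : ℝ) < (n : ℝ) + 1 := lt_of_le_of_lt h1 h2
    exact_mod_cast Nat.lt_succ_iff.1 (by exact_mod_cast h3)
  · have h1 : (⌊t / τ⌋₊ : ℝ) ≤ t / τ := Nat.floor_le (div_nonneg ht.1 hτ.le)
    rwa [le_div_iff₀ hτ] at h1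
  · have h1 : t / τ < (⌊t / τ⌋₊ : ℝ) + 1 := Nat.lt_floor_add_one _
    rw [div_lt_iff₀ hτ] at h1
    linarith

/-! ### Smoothness of the building blocks -/

/-- The exact solutions are jointly smooth on their life spans (as closed intervals). [folklore] -/
theorem IsGlueFamily.smooth_v {i : ℕ} (hi : i ≤ n) :
    FunctionSpaces.Torus.IsSmoothSpaceTimeOn (Icc (max ((i : ℝ) * τ - τ) 0) (min ((i : ℝ) * τ + τ) T)) (v i) := by
  rw [← glueInterval_eq_Icc T τ i]
  exact (h.exact i (h.anchor_le hi)).smooth_velocity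

/-- The pressures are jointly smooth on the life spans. [folklore] -/
theorem IsGlueFamily.smooth_p {i : ℕ} (hi : i ≤ n) :
    FunctionSpaces.Torus.IsSmoothSpaceTimeOn (Icc (max ((i : ℝ) * τ - τ) 0) (min ((i : ℝ) * τ + τ) T)) (p i) := by
  rw [← glueInterval_eq_Icc T τ i]
  exact (h.exact i (h.anchor_le hi)).smooth_pressure

/-- For `k < n`, `[t_k, t_k + τ]` lies in both life spans `S_k`, `S_{k+1}` (and in `[0,T]`). [folklore] -/
theorem IsGlueFamily.Icc_subset_glueInterval {k : ℕ} (hk : k < n) :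
    Icc ((k : ℝ) * τ) ((k : ℝ) * τ + τ) ⊆ glueInterval T τ k ∧
      Icc ((k : ℝ) * τ) ((k : ℝ) * τ + τ) ⊆ glueInterval T τ (k + 1) := by
  have hsub : Icc ((k : ℝ) * τ) ((k : ℝ) * τ + τ) ⊆ Icc ((k : ℝ) * τ) ((k : ℝ) * τ + τ) ∩ Icc 0 T := by
    intro t ht
    have h0 : (0 : ℝ) ≤ (k : ℝ) * τ := by have := h.hτ.le; positivity
    exact ⟨ht, ⟨le_trans h0 ht.1, le_trans ht.2 (h.anchor_add_le hk)⟩⟩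
  exact ⟨hsub.trans (h.Icc_inter_subset_glueInterval k), hsub.trans (h.Icc_inter_subset_glueInterval_succ k)⟩

/-- For `k < n` the difference `w_k = v_k - v_{k+1}` is jointly smooth on `[t_k, t_k + τ]`. [folklore] -/
theorem IsGlueFamily.smooth_velDiff {k : ℕ} (hk : k < n) :
    FunctionSpaces.Torus.IsSmoothSpaceTimeOn (Icc ((k : ℝ) * τ) ((k : ℝ) * τ + τ)) (velDiff v k) := by
  obtain ⟨h1, h2⟩ := h.Icc_subset_glueInterval hk
  exact ((h.exact k (h.anchor_le hk.le)).smooth_velocity.mono h1).sub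
    ((h.exact (k + 1) (h.anchor_le (Nat.succ_le_of_lt hk))).smooth_velocity.mono h2)

/-- For `k < n`, `ℛ(w_k)` is jointly smooth on `[t_k, t_k + τ]`. [folklore] -/
theorem IsGlueFamily.smooth_antidivergence {k : ℕ} (hk : k < n) :
    FunctionSpaces.Torus.IsSmoothSpaceTimeOn (Icc ((k : ℝ) * τ) ((k : ℝ) * τ + τ)) (fun t => Torus.antidivergence (velDiff v k t)) := by
  have hint : (interior (Icc ((k : ℝ) * τ) ((k : ℝ) * τ + τ))).Nonempty := by
    rw [interior_Icc]; exact nonempty_Ioo.2 (by linarith [h.hτ])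
  exact (h.smooth_velDiff hk).antidivergence (convex_Icc _ _) hint

/-- For `k < n`, `w_k ⊗̊ w_k` is jointly smooth on `[t_k, t_k + τ]`. [folklore] -/
theorem IsGlueFamily.smooth_tracelessSq {k : ℕ} (hk : k < n) :
    FunctionSpaces.Torus.IsSmoothSpaceTimeOn (Icc ((k : ℝ) * τ) ((k : ℝ) * τ + τ)) (fun t => Torus.tracelessSq (velDiff v k t)) := by
  have hw := h.smooth_velDiff hk
  have hcomp : ∀ j : Fin 3, ContDiffOn ℝ ∞ (fun z : ℝ × EuclideanSpace ℝ (Fin 3) =>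
      FunctionSpaces.Torus.stLift (fun t x => Torus.tracelessSq (velDiff v k t) x j) z) (Icc ((k : ℝ) * τ) ((k : ℝ) * τ + τ) ×ˢ univ) := by
    intro j
    have e : (fun z : ℝ × EuclideanSpace ℝ (Fin 3) => FunctionSpaces.Torus.stLift (fun t x => Torus.tracelessSq (velDiff v k t) x j) z) =
        fun z => (FunctionSpaces.Torus.stLift (velDiff v k) z) j • FunctionSpaces.Torus.stLift (velDiff v k) z -
          (‖FunctionSpaces.Torus.stLift (velDiff v k) z‖ ^ 2 / Fintype.card (Fin 3)) • EuclideanSpace.single j (1 : ℝ) := by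
      funext z
      simp [FunctionSpaces.Torus.stLift, Torus.tracelessSq]
    rw [e]
    have hj : ContDiffOn ℝ ∞ (fun z => (FunctionSpaces.Torus.stLift (velDiff v k) z) j) (Icc ((k : ℝ) * τ) ((k : ℝ) * τ + τ) ×ˢ univ) :=
      hw.apply j
    exact (hj.smul hw).sub (((hw.norm_sq ℝ).div_const _).smul contDiffOn_const)
  unfold FunctionSpaces.Torus.IsSmoothSpaceTimeOn
  exact contDiffOn_pi.2 hcomp

/-- For `k < n`, `|w_k|²/3` is jointly smooth on `[t_k, t_k + τ]`. [folklore] -/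
theorem IsGlueFamily.smooth_sqThird {k : ℕ} (hk : k < n) :
    FunctionSpaces.Torus.IsSmoothSpaceTimeOn (Icc ((k : ℝ) * τ) ((k : ℝ) * τ + τ)) (sqThird (velDiff v k)) :=
  ((h.smooth_velDiff hk).norm_sq ℝ).div_const _

/-- For `k < n`, `|w_k|²/3 - ∫|w_k|²/3` is jointly smooth on `[t_k, t_k + τ]`. [folklore] -/
theorem IsGlueFamily.smooth_sqThird_sub {k : ℕ} (hk : k < n) :
    FunctionSpaces.Torus.IsSmoothSpaceTimeOn (Icc ((k : ℝ) * τ) ((k : ℝ) * τ + τ))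
      (fun t x => sqThird (velDiff v k) t x - ∫ y, sqThird (velDiff v k) t y) :=
  (h.smooth_sqThird hk).sub ((h.smooth_sqThird hk).integral_const (uniqueDiffOn_Icc (by linarith [h.hτ])) (convex_Icc _ _))

/-! ### The cut-offs are admissible -/

/-- The velocity/pressure cut-off `χ_k` is admissible for the life span `S_k` relative to `[0,T]`. [folklore] -/
theorem IsGlueFamily.isTimeCutoff_glueCutoff {k : ℕ} (hk : k ≤ n) :
    Torus.IsTimeCutoff (Icc 0 T) (max ((k : ℝ) * τ - τ) 0) (min ((k : ℝ) * τ + τ) T) (glueCutoff τ n k) where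
  contDiff := contDiff_glueCutoff τ n k
  left := by
    rcases Nat.eq_zero_or_pos k with rfl | hk0
    · left
      intro t ht
      have e : max (((0 : ℕ) : ℝ) * τ - τ) 0 = 0 := max_eq_right (by simp [h.hτ.le])
      rw [mem_Ici, e]
      exact ht.1
    · right
      refine ⟨(k : ℝ) * τ - 2 * τ / 3, ?_, fun t ht => glueCutoff_eq_zero_of_le h.hτ hk0 ht⟩
      have h1 : (1 : ℝ) ≤ k := by exact_mod_cast hk0
      refine max_lt (by linarith [h.hτ]) ?_
      nlinarith [h.hτ]
  right := by
    rcases lt_or_eq_of_le hk with hk' | rfl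
    · right
      refine ⟨(k : ℝ) * τ + 2 * τ / 3, ?_, fun t ht => glueCutoff_eq_zero_of_ge h.hτ hk' ht⟩
      refine lt_min (by linarith [h.hτ]) ?_
      linarith [h.anchor_add_le hk', h.hτ]
    · left
      intro t ht
      have e : min ((k : ℝ) * τ + τ) T = T := min_eq_right (by linarith [h.hn'])
      rw [mem_Iic, e]
      exact ht.2

/-- The step derivative `θ_k'` (`k < n`) is admissible for `[t_k, t_k + τ]` relative to `[0,T]`. [folklore] -/
theorem IsGlueFamily.isTimeCutoff_stepDeriv {k : ℕ} (hk : k < n) :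
    Torus.IsTimeCutoff (Icc 0 T) ((k : ℝ) * τ) ((k : ℝ) * τ + τ) (stepDeriv τ n k) where
  contDiff := by
    unfold stepDeriv
    have e : upperStep τ n k = glueStep τ (k * τ) := funext fun s => upperStep_of_lt hk τ s
    rw [e]
    exact (contDiff_glueStep (n := ⊤) τ _).deriv'
  left := Or.inr ⟨(k : ℝ) * τ + τ / 3, by linarith [h.hτ], fun t ht => by
    unfold stepDeriv
    rw [show upperStep τ n k = glueStep τ (k * τ) from funext fun s => upperStep_of_lt hk τ s]
    exact deriv_glueStep_eq_zero h.hτ (Or.inl ht)⟩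
  right := Or.inr ⟨(k : ℝ) * τ + 2 * τ / 3, by linarith [h.hτ], fun t ht => by
    unfold stepDeriv
    rw [show upperStep τ n k = glueStep τ (k * τ) from funext fun s => upperStep_of_lt hk τ s]
    exact deriv_glueStep_eq_zero h.hτ (Or.inr ht)⟩

/-- The transition weight `θ_k(1-θ_k)` (`k < n`) is admissible for `[t_k, t_k + τ]`. [folklore] -/
theorem IsGlueFamily.isTimeCutoff_stepWeight {k : ℕ} (hk : k < n) :
    Torus.IsTimeCutoff (Icc 0 T) ((k : ℝ) * τ) ((k : ℝ) * τ + τ) (stepWeight τ n k) where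
  contDiff := (contDiff_upperStep τ n k).mul (contDiff_const.sub (contDiff_upperStep τ n k))
  left := Or.inr ⟨(k : ℝ) * τ + τ / 3, by linarith [h.hτ], fun t ht => by
    unfold stepWeight
    rw [upperStep_of_lt hk]
    exact glueStep_mul_one_sub_eq_zero h.hτ (Or.inl ht)⟩
  right := Or.inr ⟨(k : ℝ) * τ + 2 * τ / 3, by linarith [h.hτ], fun t ht => by
    unfold stepWeight
    rw [upperStep_of_lt hk]
    exact glueStep_mul_one_sub_eq_zero h.hτ (Or.inr ht)⟩

/-! ### Smoothness of the glued fields on `[0,T]` -/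

/-- **The glued velocity is jointly smooth on `[0,T] × T³`.** [cite: BuckmasterEtAl2018, §4.2] -/
theorem IsGlueFamily.smooth_gluedVel : FunctionSpaces.Torus.IsSmoothSpaceTimeOn (Icc 0 T) (gluedVel τ n v) :=
  FunctionSpaces.Torus.IsSmoothSpaceTimeOn.sum fun _ hk =>
    (h.isTimeCutoff_glueCutoff (Nat.lt_succ_iff.1 (Finset.mem_range.1 hk))).isSmoothSpaceTimeOn_smul
      (h.smooth_v (Nat.lt_succ_iff.1 (Finset.mem_range.1 hk)))

/-- **The glued pressure is jointly smooth on `[0,T] × T³`.** [cite: BuckmasterEtAl2018, §4.2] -/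
theorem IsGlueFamily.smooth_gluedPres : FunctionSpaces.Torus.IsSmoothSpaceTimeOn (Icc 0 T) (gluedPres τ n v p) := by
  refine (FunctionSpaces.Torus.IsSmoothSpaceTimeOn.sum fun k hk => ?_).add (FunctionSpaces.Torus.IsSmoothSpaceTimeOn.sum fun k hk => ?_)
  · have hk' := Nat.lt_succ_iff.1 (Finset.mem_range.1 hk)
    have := (h.isTimeCutoff_glueCutoff hk').isSmoothSpaceTimeOn_smul (h.smooth_p hk')
    simpa only [smul_eq_mul] using this
  · have hk' := Finset.mem_range.1 hk
    have := (h.isTimeCutoff_stepWeight hk').isSmoothSpaceTimeOn_smul (h.smooth_sqThird_sub hk')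
    simpa only [smul_eq_mul] using this

/-- **The glued stress is jointly smooth on `[0,T] × T³`** ("`R̊̄_q` is a smooth … 2-tensor",
BDSV §4.2). [cite: BuckmasterEtAl2018, §4.2] -/
theorem IsGlueFamily.smooth_gluedStress : FunctionSpaces.Torus.IsSmoothSpaceTimeOn (Icc 0 T) (gluedStress τ n v) := by
  have hsum : FunctionSpaces.Torus.IsSmoothSpaceTimeOn (Icc 0 T) (fun t x => ∑ k ∈ Finset.range n,
      (stepDeriv τ n k t • Torus.antidivergence (velDiff v k t) x -
        stepWeight τ n k t • Torus.tracelessSq (velDiff v k t) x)) := by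
    refine FunctionSpaces.Torus.IsSmoothSpaceTimeOn.sum fun k hk => ?_
    have hk' := Finset.mem_range.1 hk
    exact ((h.isTimeCutoff_stepDeriv hk').isSmoothSpaceTimeOn_smul (h.smooth_antidivergence hk')).sub
      ((h.isTimeCutoff_stepWeight hk').isSmoothSpaceTimeOn_smul (h.smooth_tracelessSq hk'))
  refine ContDiffOn.congr hsum fun q _ => ?_
  funext j
  simp [gluedStress, FunctionSpaces.Torus.stLift, Finset.sum_apply]

/-! ### Which cut-offs are active on `[t_i, t_i + τ]` -/

section Active

variable {i k : ℕ} {t : ℝ}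

/-- A cut-off `χ_k` with `k < i` vanishes identically near every `t ≥ t_i`. [folklore] -/
theorem IsGlueFamily.glueCutoff_eventuallyEq_zero_of_lt (hki : k < i) (hin : i ≤ n) (ht : (i : ℝ) * τ ≤ t) :
    glueCutoff τ n k =ᶠ[𝓝 t] fun _ => (0 : ℝ) := by
  have hkn : k < n := lt_of_lt_of_le hki hin
  have hk1 : (k : ℝ) + 1 ≤ i := by exact_mod_cast Nat.succ_le_of_lt hki
  have hlt : (k : ℝ) * τ + 2 * τ / 3 < t := by nlinarith [h.hτ]
  filter_upwards [isOpen_Ioi.mem_nhds hlt] with s hs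
  exact glueCutoff_eq_zero_of_ge h.hτ hkn (le_of_lt hs)

/-- A cut-off `χ_k` with `k > i + 1` vanishes identically near every `t ≤ t_i + τ`. [folklore] -/
theorem IsGlueFamily.glueCutoff_eventuallyEq_zero_of_gt (hki : i + 1 < k) (ht : t ≤ (i : ℝ) * τ + τ) :
    glueCutoff τ n k =ᶠ[𝓝 t] fun _ => (0 : ℝ) := by
  have hk1 : (i : ℝ) + 2 ≤ k := by exact_mod_cast Nat.succ_le_of_lt hki
  have hlt : t < (k : ℝ) * τ - 2 * τ / 3 := by nlinarith [h.hτ]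
  filter_upwards [isOpen_Iio.mem_nhds hlt] with s hs
  exact glueCutoff_eq_zero_of_le h.hτ (by omega) (le_of_lt hs)

/-- On `[t_i, t_i + τ]` the cut-offs `χ_k`, `k ∉ {i, i+1}`, vanish together with their
derivatives. [folklore] -/
theorem IsGlueFamily.glueCutoff_inactive (hin : i ≤ n) (hki : k ≠ i) (hki' : k ≠ i + 1)
    (ht : t ∈ Icc ((i : ℝ) * τ) ((i : ℝ) * τ + τ)) :
    glueCutoff τ n k t = 0 ∧ deriv (glueCutoff τ n k) t = 0 := by
  have hev : glueCutoff τ n k =ᶠ[𝓝 t] fun _ => (0 : ℝ) := by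
    rcases Nat.lt_or_gt_of_ne hki with hlt | hgt
    · exact h.glueCutoff_eventuallyEq_zero_of_lt hlt hin ht.1
    · exact h.glueCutoff_eventuallyEq_zero_of_gt (by omega) ht.2
  refine ⟨?_, ?_⟩
  · exact hev.self_of_nhds
  · rw [hev.deriv_eq, deriv_const]

/-- On `[t_i - τ/3, ∞)` the `i`-th cut-off is its upper step (`θ_{t_i}`, or `1` if `i = n`). [folklore] -/
theorem IsGlueFamily.glueCutoff_eq_upperStep (hin : i ≤ n) {s : ℝ} (hs : (i : ℝ) * τ - τ / 3 ≤ s) :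
    glueCutoff τ n i s = upperStep τ n i s := by
  rcases lt_or_eq_of_le hin with hi | rfl
  · rw [glueCutoff_eq_glueStep h.hτ hi hs, upperStep_of_lt hi]
  · rw [upperStep_of_le le_rfl]
    exact glueCutoff_eq_one h.hτ le_rfl (by
      rcases Nat.eq_zero_or_pos i with h0 | h0
      · exact Or.inl h0
      · exact Or.inr hs) (Or.inl rfl)

/-- Near a time of `[t_i, t_i + τ]`, `χ_i` coincides with its upper step. [folklore] -/
theorem IsGlueFamily.glueCutoff_eventuallyEq_upperStep (hin : i ≤ n) (ht : t ∈ Icc ((i : ℝ) * τ) ((i : ℝ) * τ + τ)) :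
    glueCutoff τ n i =ᶠ[𝓝 t] upperStep τ n i := by
  have hlt : (i : ℝ) * τ - τ / 3 < t := by linarith [ht.1, h.hτ]
  filter_upwards [isOpen_Ioi.mem_nhds hlt] with s hs
  exact h.glueCutoff_eq_upperStep hin (le_of_lt hs)

/-- Near a time of `[t_i, t_i + τ]`, `i < n`, `χ_{i+1} = 1 - θ_{t_i}`. [folklore] -/
theorem IsGlueFamily.glueCutoff_succ_eventuallyEq (hin : i < n) (ht : t ∈ Icc ((i : ℝ) * τ) ((i : ℝ) * τ + τ)) :
    glueCutoff τ n (i + 1) =ᶠ[𝓝 t] fun s => 1 - upperStep τ n i s := by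
  have hlt : t < (i : ℝ) * τ + τ + τ / 3 := by linarith [ht.2, h.hτ]
  filter_upwards [isOpen_Iio.mem_nhds hlt] with s hs
  rw [glueCutoff_succ_eq_one_sub_glueStep h.hτ hin (le_of_lt hs), upperStep_of_lt hin]

/-- Values and derivatives of the two active cut-offs on `[t_i, t_i + τ]`:
`χ_i = θ`, `χ_i' = θ'`, and for `i < n`: `χ_{i+1} = 1 - θ`, `χ_{i+1}' = -θ'`, `θ = upperStep i`. [folklore] -/
theorem IsGlueFamily.glueCutoff_active (hin : i ≤ n) (ht : t ∈ Icc ((i : ℝ) * τ) ((i : ℝ) * τ + τ)) :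
    glueCutoff τ n i t = upperStep τ n i t ∧ deriv (glueCutoff τ n i) t = stepDeriv τ n i t ∧
      (i < n → glueCutoff τ n (i + 1) t = 1 - upperStep τ n i t ∧
        deriv (glueCutoff τ n (i + 1)) t = -stepDeriv τ n i t) := by
  have hev := h.glueCutoff_eventuallyEq_upperStep hin ht
  refine ⟨hev.self_of_nhds, by rw [hev.deriv_eq]; rfl, fun hi => ?_⟩
  have hev' := h.glueCutoff_succ_eventuallyEq hi ht
  refine ⟨hev'.self_of_nhds, ?_⟩
  rw [hev'.deriv_eq, deriv_const_sub, stepDeriv]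

omit h in
/-- The step derivative of index `k ≥ n` vanishes. [folklore] -/
theorem stepDeriv_of_le (hk : n ≤ k) (t : ℝ) : stepDeriv τ n k t = 0 := by
  unfold stepDeriv
  rw [show upperStep τ n k = fun _ => (1 : ℝ) from funext fun s => upperStep_of_le hk τ s, deriv_const]

omit h in
/-- The weight of index `k ≥ n` vanishes. [folklore] -/
theorem stepWeight_of_le (hk : n ≤ k) (t : ℝ) : stepWeight τ n k t = 0 := by
  unfold stepWeight
  rw [upperStep_of_le hk]
  ring

/-- On `[t_i, t_i + τ]` the step derivatives and weights of the other indices `k < n`, `k ≠ i`,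
vanish (the transition windows are disjoint). [folklore] -/
theorem IsGlueFamily.step_inactive (hkn : k < n) (hki : k ≠ i) (ht : t ∈ Icc ((i : ℝ) * τ) ((i : ℝ) * τ + τ)) :
    stepDeriv τ n k t = 0 ∧ stepWeight τ n k t = 0 := by
  have e : upperStep τ n k = glueStep τ (k * τ) := funext fun s => upperStep_of_lt hkn τ s
  have hcase : t ≤ (k : ℝ) * τ + τ / 3 ∨ (k : ℝ) * τ + 2 * τ / 3 ≤ t := by
    rcases Nat.lt_or_gt_of_ne hki with hlt | hgt
    · right
      have hk1 : (k : ℝ) + 1 ≤ i := by exact_mod_cast Nat.succ_le_of_lt hlt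
      nlinarith [ht.1, h.hτ]
    · left
      have hk1 : (i : ℝ) + 1 ≤ k := by exact_mod_cast Nat.succ_le_of_lt hgt
      nlinarith [ht.2, h.hτ]
  refine ⟨?_, ?_⟩
  · unfold stepDeriv
    rw [e]
    exact deriv_glueStep_eq_zero h.hτ hcase
  · unfold stepWeight
    rw [upperStep_of_lt hkn]
    exact glueStep_mul_one_sub_eq_zero h.hτ hcase

omit h in
/-- **Collapse of a sum over the cut-offs** to the two active indices. [folklore] -/
theorem sum_range_succ_collapse {β : Type*} [AddCommMonoid β] (hin : i ≤ n) (G : ℕ → β)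
    (hG : ∀ k ∈ Finset.range (n + 1), k ≠ i → k ≠ i + 1 → G k = 0) :
    ∑ k ∈ Finset.range (n + 1), G k = G i + if i < n then G (i + 1) else 0 := by
  classical
  have e : ∀ k ∈ Finset.range (n + 1), G k = (if k = i then G i else 0) + (if k = i + 1 then G (i + 1) else 0) := by
    intro k hk
    by_cases h1 : k = i
    · subst h1; simp
    · by_cases h2 : k = i + 1
      · subst h2; simp
      · simp [h1, h2, hG k hk h1 h2]
  rw [Finset.sum_congr rfl e, Finset.sum_add_distrib, Finset.sum_ite_eq', Finset.sum_ite_eq']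
  have hi_mem : i ∈ Finset.range (n + 1) := Finset.mem_range.2 (Nat.lt_succ_of_le hin)
  simp only [hi_mem, if_true, Finset.mem_range, Nat.succ_lt_succ_iff]

omit h in
/-- **Collapse of a sum over the transition terms** to the active index. [folklore] -/
theorem sum_range_collapse {β : Type*} [AddCommMonoid β] (G : ℕ → β)
    (hG : ∀ k ∈ Finset.range n, k ≠ i → G k = 0) :
    ∑ k ∈ Finset.range n, G k = if i < n then G i else 0 := by
  classical
  have e : ∀ k ∈ Finset.range n, G k = if k = i then G i else 0 := by
    intro k hk
    by_cases h1 : k = i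
    · subst h1; simp
    · simp [h1, hG k hk h1]
  rw [Finset.sum_congr rfl e, Finset.sum_ite_eq']
  simp only [Finset.mem_range]

end Active

/-! ### The glued fields at a time of `[t_i, t_i + τ]` -/

section LocalFormulas

variable {i : ℕ} {t : ℝ}

/-- **`v̄ = θ v_i + (1-θ) v_{i+1}` on `[t_i, t_i + τ]`**, `θ = upperStep i` (for `i = n`, `θ = 1`
and `v̄ = v_n`) (BDSV §4.1: "if `t ∈ I_i` then `χ_i + χ_{i+1} = 1` … `v̄_q = χᵢvᵢ + (1-χᵢ)vᵢ₊₁`";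
on `J_i`, `v̄_q = v_i`). [cite: BuckmasterEtAl2018, §4.1] -/
theorem IsGlueFamily.gluedVel_apply (hin : i ≤ n) (ht : t ∈ Icc ((i : ℝ) * τ) ((i : ℝ) * τ + τ)) (x : 𝕋³) :
    gluedVel τ n v t x = upperStep τ n i t • v i t x + (1 - upperStep τ n i t) • v (i + 1) t x := by
  obtain ⟨hci, -, hsucc⟩ := h.glueCutoff_active hin ht
  unfold gluedVel
  rw [sum_range_succ_collapse hin (fun k => glueCutoff τ n k t • v k t x) fun k hk hk1 hk2 => by
    rw [(h.glueCutoff_inactive hin hk1 hk2 ht).1, zero_smul]]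
  rcases lt_or_eq_of_le hin with hi | rfl
  · rw [if_pos hi, hci, (hsucc hi).1]
  · rw [if_neg (lt_irrefl _), hci, upperStep_of_le le_rfl, sub_self, zero_smul]

/-- For `i = n`: `v̄(t) = v_n(t)` on `[t_n, T]`. [cite: BuckmasterEtAl2018, §4.1] -/
theorem IsGlueFamily.gluedVel_apply_last (ht : t ∈ Icc ((n : ℝ) * τ) ((n : ℝ) * τ + τ)) (x : 𝕋³) :
    gluedVel τ n v t x = v n t x := by
  rw [h.gluedVel_apply le_rfl ht x, upperStep_of_le le_rfl, one_smul, sub_self, zero_smul, add_zero]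

omit h in
/-- **`v̄ - v_ℓ = ∑ χ_k (v_k - v_ℓ)`** (partition of unity; BDSV, proof of Prop. 4.2). [cite: BuckmasterEtAl2018, Prop. 4.2 (proof)] -/
theorem gluedVel_sub_eq_sum (t : ℝ) (x : 𝕋³) :
    gluedVel τ n v t x - vℓ t x = ∑ k ∈ Finset.range (n + 1), glueCutoff τ n k t • (v k t x - vℓ t x) := by
  unfold gluedVel
  simp only [smul_sub, Finset.sum_sub_distrib, ← Finset.sum_smul, sum_glueCutoff τ n t, one_smul]

/-- **`R̊̄ = θ' ℛ(w_i) - θ(1-θ) w_i ⊗̊ w_i` on `[t_i, t_i + τ]`** (`i < n`), and `R̊̄ = 0` there if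
`i = n` (BDSV §4.2). [cite: BuckmasterEtAl2018, §4.2] -/
theorem IsGlueFamily.gluedStress_apply (ht : t ∈ Icc ((i : ℝ) * τ) ((i : ℝ) * τ + τ)) (x : 𝕋³) (j : Fin 3) :
    gluedStress τ n v t x j = if i < n then
      stepDeriv τ n i t • Torus.antidivergence (velDiff v i t) x j -
        stepWeight τ n i t • Torus.tracelessSq (velDiff v i t) x j else 0 := by
  unfold gluedStress
  exact sum_range_collapse (fun k => stepDeriv τ n k t • Torus.antidivergence (velDiff v k t) x j -
      stepWeight τ n k t • Torus.tracelessSq (velDiff v k t) x j) fun k hk hki => by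
    obtain ⟨h1, h2⟩ := h.step_inactive (Finset.mem_range.1 hk) hki ht
    rw [h1, h2, zero_smul, zero_smul, sub_zero]

/-- **The glued pressure on `[t_i, t_i + τ]`**: `p̄ = θ p_i + (1-θ) p_{i+1} + θ(1-θ)(q_i - ∫q_i)`
for `i < n` (and `p̄ = p_n` for `i = n`). [cite: BuckmasterEtAl2018, §4.2] -/
theorem IsGlueFamily.gluedPres_apply (hin : i ≤ n) (ht : t ∈ Icc ((i : ℝ) * τ) ((i : ℝ) * τ + τ)) (x : 𝕋³) :
    gluedPres τ n v p t x = upperStep τ n i t * p i t x + (1 - upperStep τ n i t) * p (i + 1) t x +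
      stepWeight τ n i t * (sqThird (velDiff v i) t x - ∫ y, sqThird (velDiff v i) t y) := by
  obtain ⟨hci, -, hsucc⟩ := h.glueCutoff_active hin ht
  unfold gluedPres
  rw [sum_range_succ_collapse hin (fun k => glueCutoff τ n k t * p k t x) fun k hk hk1 hk2 => by
      rw [(h.glueCutoff_inactive hin hk1 hk2 ht).1, zero_mul],
    sum_range_collapse (fun k => stepWeight τ n k t * (sqThird (velDiff v k) t x - ∫ y, sqThird (velDiff v k) t y))
      fun k hk hki => by rw [(h.step_inactive (Finset.mem_range.1 hk) hki ht).2, zero_mul]]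
  rcases lt_or_eq_of_le hin with hi | rfl
  · rw [if_pos hi, if_pos hi, hci, (hsucc hi).1]
  · rw [if_neg (lt_irrefl _), if_neg (lt_irrefl _), hci, upperStep_of_le le_rfl, stepWeight_of_le le_rfl]
    ring

/-- **The time derivative of `v̄` within `[0,T]`** at a time of `[t_i, t_i + τ]`:
`∂ₜv̄ = θ'v_i + θ∂ₜv_i - θ'v_{i+1} + (1-θ)∂ₜv_{i+1}`, the derivatives of the exact solutions
being taken within their life spans (BDSV §4.1, the first line of the computation). [cite: BuckmasterEtAl2018, §4.1] -/
theorem IsGlueFamily.timeDerivWithin_gluedVel (hin : i ≤ n) (ht : t ∈ Icc ((i : ℝ) * τ) ((i : ℝ) * τ + τ))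
    (htT : t ∈ Icc 0 T) (x : 𝕋³) :
    FunctionSpaces.Torus.timeDerivWithin (Icc 0 T) (gluedVel τ n v) t x =
      stepDeriv τ n i t • v i t x +
        upperStep τ n i t • FunctionSpaces.Torus.timeDerivWithin
          (Icc (max ((i : ℝ) * τ - τ) 0) (min ((i : ℝ) * τ + τ) T)) (v i) t x +
      (-(stepDeriv τ n i t) • v (i + 1) t x +
        (1 - upperStep τ n i t) • FunctionSpaces.Torus.timeDerivWithin
          (Icc (max (((i + 1 : ℕ) : ℝ) * τ - τ) 0) (min (((i + 1 : ℕ) : ℝ) * τ + τ) T)) (v (i + 1)) t x) := by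
  obtain ⟨hci, hci', hsucc⟩ := h.glueCutoff_active hin ht
  -- term-wise derivatives
  set D : ℕ → ℝ³ := fun k => FunctionSpaces.Torus.timeDerivWithin
    (Icc (max ((k : ℝ) * τ - τ) 0) (min ((k : ℝ) * τ + τ) T)) (v k) t x with hD
  have hsum : HasDerivWithinAt (fun s => ∑ k ∈ Finset.range (n + 1), glueCutoff τ n k s • v k s x)
      (∑ k ∈ Finset.range (n + 1), (deriv (glueCutoff τ n k) t • v k t x + glueCutoff τ n k t • D k)) (Icc 0 T) t := by
    refine HasDerivWithinAt.fun_sum fun k hk => ?_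
    have hk' := Nat.lt_succ_iff.1 (Finset.mem_range.1 hk)
    rcases Nat.lt_or_ge n k with hnk | hnk
    · exact absurd hk' (not_le.2 hnk)
    · exact (h.isTimeCutoff_glueCutoff hk').hasDerivWithinAt_smul (h.smooth_v hk') htT x
  have hcoll : ∑ k ∈ Finset.range (n + 1), (deriv (glueCutoff τ n k) t • v k t x + glueCutoff τ n k t • D k) =
      stepDeriv τ n i t • v i t x + upperStep τ n i t • D i +
        (-(stepDeriv τ n i t) • v (i + 1) t x + (1 - upperStep τ n i t) • D (i + 1)) := by
    rw [sum_range_succ_collapse hin (fun k => deriv (glueCutoff τ n k) t • v k t x + glueCutoff τ n k t • D k)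
      fun k hk hk1 hk2 => by
        obtain ⟨h0, h0'⟩ := h.glueCutoff_inactive hin hk1 hk2 ht
        rw [h0, h0', zero_smul, zero_smul, add_zero]]
    rcases lt_or_eq_of_le hin with hi | rfl
    · rw [if_pos hi, hci, hci', (hsucc hi).1, (hsucc hi).2]
    · rw [if_neg (lt_irrefl _), hci, hci', upperStep_of_le le_rfl, stepDeriv_of_le le_rfl]
      simp
  rw [hcoll] at hsum
  exact hsum.derivWithin (uniqueDiffOn_Icc h.hT t htT)

end LocalFormulas

/-! ### The Euler–Reynolds system of the glued triple -/

section EulerReynolds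

variable {i : ℕ} {t : ℝ}

/-- `t ∈ [t_i, t_i+τ] ∩ [0,T]` lies in the closed life span of `v_i` (`i ≤ n`). [folklore] -/
theorem IsGlueFamily.mem_span (ht : t ∈ Icc ((i : ℝ) * τ) ((i : ℝ) * τ + τ)) (htT : t ∈ Icc 0 T) :
    t ∈ Icc (max ((i : ℝ) * τ - τ) 0) (min ((i : ℝ) * τ + τ) T) := by
  rw [← glueInterval_eq_Icc T τ i]
  exact h.Icc_inter_subset_glueInterval i ⟨ht, htT⟩

/-- `t ∈ [t_i, t_i+τ] ∩ [0,T]` lies in the closed life span of `v_{i+1}`. [folklore] -/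
theorem IsGlueFamily.mem_span_succ (ht : t ∈ Icc ((i : ℝ) * τ) ((i : ℝ) * τ + τ)) (htT : t ∈ Icc 0 T) :
    t ∈ Icc (max (((i + 1 : ℕ) : ℝ) * τ - τ) 0) (min (((i + 1 : ℕ) : ℝ) * τ + τ) T) := by
  rw [← glueInterval_eq_Icc T τ (i + 1)]
  exact h.Icc_inter_subset_glueInterval_succ i ⟨ht, htT⟩

/-- The Euler equation of `v_i` at a time of its life span, with the time derivative within the
closed life span and the zero stress simplified. [folklore] -/
theorem IsGlueFamily.euler (hin : i ≤ n) {s : ℝ} (hs : s ∈ Icc (max ((i : ℝ) * τ - τ) 0) (min ((i : ℝ) * τ + τ) T))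
    (x : 𝕋³) :
    FunctionSpaces.Torus.timeDerivWithin (Icc (max ((i : ℝ) * τ - τ) 0) (min ((i : ℝ) * τ + τ) T)) (v i) s x +
        FunctionSpaces.Torus.convect (v i s) (v i s) x + FunctionSpaces.Torus.gradient (p i s) x = 0 := by
  have hex := h.exact i (h.anchor_le hin)
  have hs' : s ∈ glueInterval T τ i := by rwa [glueInterval_eq_Icc]
  have hm := hex.momentum s hs' x
  rw [glueInterval_eq_Icc] at hm
  rw [hm]
  simp

/-- **Conservation of momentum along the family**: `∫ v_i(t) = ∫ v_ℓ(0)` on the life span of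
`v_i` (exact solutions and the mollified triple conserve momentum, and `v_i(t_i) = v_ℓ(t_i)`). [folklore] -/
theorem IsGlueFamily.integral_v_eq (hin : i ≤ n) {s : ℝ} (hs : s ∈ Icc (max ((i : ℝ) * τ - τ) 0) (min ((i : ℝ) * τ + τ) T)) :
    ∫ x, v i s x = ∫ x, vℓ 0 x := by
  have hiT := h.anchor_le hin
  have hex := h.exact i hiT
  have hanchor : (i : ℝ) * τ ∈ Icc (max ((i : ℝ) * τ - τ) 0) (min ((i : ℝ) * τ + τ) T) := by
    rw [← glueInterval_eq_Icc]
    exact anchor_mem_glueInterval h.hτ.le hiT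
  have hexI : Torus.IsEulerReynoldsOn (Icc (max ((i : ℝ) * τ - τ) 0) (min ((i : ℝ) * τ + τ) T)) (v i) (p i) (fun _ _ _ => 0) := by
    have := hex
    unfold IsExactEulerOn at this
    rwa [glueInterval_eq_Icc] at this
  rw [hexI.integral_velocity_eq hs hanchor, h.anchor i hiT,
    h.er.integral_velocity_eq ⟨by have := h.hτ.le; positivity, hiT⟩ ⟨le_rfl, h.hT.le⟩]

/-- **`w_i = v_i - v_{i+1}` has zero mean** on `[t_i, t_i + τ]`, `i < n` (so that `div ℛw_i = w_i`,
Prop. 4.1). [cite: BuckmasterEtAl2018, §4.2 (Prop. 4.1)] -/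
theorem IsGlueFamily.integral_velDiff (hi : i < n) (ht : t ∈ Icc ((i : ℝ) * τ) ((i : ℝ) * τ + τ)) :
    ∫ x, velDiff v i t x = 0 := by
  have htT : t ∈ Icc 0 T := ⟨le_trans (by have := h.hτ.le; positivity) ht.1, le_trans ht.2 (h.anchor_add_le hi)⟩
  have h1 := h.integral_v_eq hi.le (h.mem_span ht htT)
  have h2 := h.integral_v_eq (Nat.succ_le_of_lt hi) (h.mem_span_succ ht htT)
  have hv1 : FunctionSpaces.Torus.IsSmooth (v i t) := (h.smooth_v hi.le).isSmooth_slice (h.mem_span ht htT)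
  have hv2 : FunctionSpaces.Torus.IsSmooth (v (i + 1) t) :=
    (h.smooth_v (Nat.succ_le_of_lt hi)).isSmooth_slice (h.mem_span_succ ht htT)
  unfold velDiff
  rw [integral_sub hv1.integrable hv2.integrable, h1, h2, sub_self]

/-- **The momentum equation of the glued triple** at a time of `[t_i, t_i + τ]` (BDSV §4.1–4.2:
`∂ₜv̄ + div(v̄ ⊗ v̄) + ∇p̄⁽¹⁾ = ∂ₜχᵢ(vᵢ - vᵢ₊₁) - χᵢ(1-χᵢ) div((vᵢ - vᵢ₊₁) ⊗ (vᵢ - vᵢ₊₁))` on `Iᵢ`,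
`= 0` on `Jᵢ`, matched by `div R̊̄ - ∇p̄⁽²⁾` using Prop. 4.1). [cite: BuckmasterEtAl2018, §4.1–4.2] -/
theorem IsGlueFamily.momentum (hin : i ≤ n) (ht : t ∈ Icc ((i : ℝ) * τ) ((i : ℝ) * τ + τ)) (htT : t ∈ Icc 0 T)
    (x : 𝕋³) :
    FunctionSpaces.Torus.timeDerivWithin (Icc 0 T) (gluedVel τ n v) t x +
          FunctionSpaces.Torus.convect (gluedVel τ n v t) (gluedVel τ n v t) x +
        FunctionSpaces.Torus.gradient (gluedPres τ n v p t) x =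
      Torus.tensorDivergence (gluedStress τ n v t) x := by
  have hti := h.mem_span ht htT
  have hA := h.euler hin hti x
  have hvA : FunctionSpaces.Torus.IsSmooth (v i t) := (h.smooth_v hin).isSmooth_slice hti
  have hpA : FunctionSpaces.Torus.IsSmooth (p i t) := (h.smooth_p hin).isSmooth_slice hti
  rcases lt_or_eq_of_le hin with hi | rfl
  · -- two active solutions
    have hti' := h.mem_span_succ ht htT
    have hB := h.euler (Nat.succ_le_of_lt hi) hti' x
    have hvB : FunctionSpaces.Torus.IsSmooth (v (i + 1) t) := (h.smooth_v (Nat.succ_le_of_lt hi)).isSmooth_slice hti'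
    have hpB : FunctionSpaces.Torus.IsSmooth (p (i + 1) t) := (h.smooth_p (Nat.succ_le_of_lt hi)).isSmooth_slice hti'
    -- abbreviations
    set c : ℝ := upperStep τ n i t with hc_def
    set c' : ℝ := stepDeriv τ n i t with hc'_def
    have hm : stepWeight τ n i t = c * (1 - c) := rfl
    set M : ℝ := ∫ y, sqThird (velDiff v i) t y with hM_def
    -- the slices
    have hw : FunctionSpaces.Torus.IsSmooth (velDiff v i t) := hvA.sub hvB
    have hwdef : velDiff v i t = fun y => v i t y + (-1 : ℝ) • v (i + 1) t y := by
      funext y; simp [velDiff, sub_eq_add_neg]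
    have hwdiv : FunctionSpaces.Torus.IsDivFree (velDiff v i t) := by
      rw [hwdef]
      exact IsDivFree.add (hvA.isContDiff (by simp)) ((hvB.smul (-1)).isContDiff (by simp))
        ((h.exact i (h.anchor_le hin)).divFree t (by rwa [glueInterval_eq_Icc]))
        (Torus.isDivFree_const_smul (hvB.isContDiff (by simp))
          ((h.exact (i + 1) (h.anchor_le (Nat.succ_le_of_lt hi))).divFree t (by rwa [glueInterval_eq_Icc])) _)
    have hq : FunctionSpaces.Torus.IsSmooth (sqThird (velDiff v i) t) := by
      have := hw.norm_sq.div_const (Fintype.card (Fin 3) : ℝ)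
      exact this
    have hV : gluedVel τ n v t = fun y => c • v i t y + (1 - c) • v (i + 1) t y :=
      funext fun y => h.gluedVel_apply hin ht y
    have hPr : gluedPres τ n v p t = fun y => c * p i t y + ((1 - c) * p (i + 1) t y +
        (c * (1 - c)) * (sqThird (velDiff v i) t y + (-M))) := by
      funext y
      rw [h.gluedPres_apply hin ht y, hm]
      ring
    have hSt : gluedStress τ n v t = fun y j => c' • Torus.antidivergence (velDiff v i t) y j +
        (-(c * (1 - c))) • Torus.tracelessSq (velDiff v i t) y j := by
      funext y j
      rw [h.gluedStress_apply ht y j, if_pos hi, hm, sub_eq_add_neg, neg_smul]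
    -- regularity of the pieces
    have h1A : FunctionSpaces.Torus.IsContDiff 1 (v i t) := hvA.isContDiff (by simp)
    have h1B : FunctionSpaces.Torus.IsContDiff 1 (v (i + 1) t) := hvB.isContDiff (by simp)
    have h1cA : FunctionSpaces.Torus.IsContDiff 1 (fun y => c • v i t y) := (hvA.smul c).isContDiff (by simp)
    have h1cB : FunctionSpaces.Torus.IsContDiff 1 (fun y => (1 - c) • v (i + 1) t y) := (hvB.smul (1 - c)).isContDiff (by simp)
    have h1pA : FunctionSpaces.Torus.IsContDiff 1 (p i t) := hpA.isContDiff (by simp)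
    have h1pB : FunctionSpaces.Torus.IsContDiff 1 (p (i + 1) t) := hpB.isContDiff (by simp)
    have h1q : FunctionSpaces.Torus.IsContDiff 1 (sqThird (velDiff v i) t) := hq.isContDiff (by simp)
    have h1qM : FunctionSpaces.Torus.IsContDiff 1 (fun y => sqThird (velDiff v i) t y + (-M)) :=
      (hq.add (isSmooth_const _)).isContDiff (by simp)
    have h1a : FunctionSpaces.Torus.IsContDiff 1 (fun y => (c * (1 - c)) * (sqThird (velDiff v i) t y + (-M))) :=
      ((hq.add (isSmooth_const _)).smul (c * (1 - c))).isContDiff (by simp)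
    have h1b : FunctionSpaces.Torus.IsContDiff 1 (fun y => (1 - c) * p (i + 1) t y) := (hpB.smul (1 - c)).isContDiff (by simp)
    have h1ba : FunctionSpaces.Torus.IsContDiff 1 (fun y => (1 - c) * p (i + 1) t y +
        (c * (1 - c)) * (sqThird (velDiff v i) t y + (-M))) := h1b.add h1a
    have h1cpA : FunctionSpaces.Torus.IsContDiff 1 (fun y => c * p i t y) := (hpA.smul c).isContDiff (by simp)
    have hRA : FunctionSpaces.Torus.IsSmooth (Torus.antidivergence (velDiff v i t)) := Torus.isSmooth_antidivergence hw
    have h1R : FunctionSpaces.Torus.IsContDiff 1 (fun y j => c' • Torus.antidivergence (velDiff v i t) y j) :=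
      (hRA.smul c').isContDiff (by simp)
    have h1T : FunctionSpaces.Torus.IsContDiff 1 (fun y j => (-(c * (1 - c))) • Torus.tracelessSq (velDiff v i t) y j) :=
      (hw.tracelessSq.smul _).isContDiff (by simp)
    -- the operators on the slices
    have eConv : FunctionSpaces.Torus.convect (gluedVel τ n v t) (gluedVel τ n v t) x =
        c • (c • FunctionSpaces.Torus.convect (v i t) (v i t) x + (1 - c) • FunctionSpaces.Torus.convect (v i t) (v (i + 1) t) x) +
          (1 - c) • (c • FunctionSpaces.Torus.convect (v (i + 1) t) (v i t) x +
            (1 - c) • FunctionSpaces.Torus.convect (v (i + 1) t) (v (i + 1) t) x) := by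
      rw [hV, Torus.convect_add_left, Torus.convect_smul_left, Torus.convect_smul_left, Torus.convect_add_right _ h1cA h1cB,
        Torus.convect_add_right _ h1cA h1cB, Torus.convect_smul_right _ h1A, Torus.convect_smul_right _ h1B,
        Torus.convect_smul_right _ h1A, Torus.convect_smul_right _ h1B]
    have eConvW : FunctionSpaces.Torus.convect (velDiff v i t) (velDiff v i t) x =
        FunctionSpaces.Torus.convect (v i t) (v i t) x + (-1 : ℝ) • FunctionSpaces.Torus.convect (v i t) (v (i + 1) t) x +
          (-1 : ℝ) • (FunctionSpaces.Torus.convect (v (i + 1) t) (v i t) x +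
            (-1 : ℝ) • FunctionSpaces.Torus.convect (v (i + 1) t) (v (i + 1) t) x) := by
      have h1nB : FunctionSpaces.Torus.IsContDiff 1 (fun y => (-1 : ℝ) • v (i + 1) t y) := (hvB.smul (-1)).isContDiff (by simp)
      rw [hwdef, Torus.convect_add_left, Torus.convect_smul_left, Torus.convect_add_right _ h1A h1nB, Torus.convect_add_right _ h1A h1nB,
        Torus.convect_smul_right _ h1B, Torus.convect_smul_right _ h1B]
    have eGrad : FunctionSpaces.Torus.gradient (gluedPres τ n v p t) x =
        c • FunctionSpaces.Torus.gradient (p i t) x + ((1 - c) • FunctionSpaces.Torus.gradient (p (i + 1) t) x +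
          (c * (1 - c)) • FunctionSpaces.Torus.gradient (sqThird (velDiff v i) t) x) := by
      rw [hPr, Torus.gradient_add_apply h1cpA h1ba, Torus.gradient_add_apply h1b h1a, Torus.gradient_const_mul_apply h1pA,
        Torus.gradient_const_mul_apply h1pB, Torus.gradient_const_mul_apply h1qM, Torus.gradient_add_apply h1q (isContDiff_const _),
        Torus.gradient_const, add_zero]
    have eDiv : Torus.tensorDivergence (gluedStress τ n v t) x =
        c' • velDiff v i t x + (-(c * (1 - c))) • (FunctionSpaces.Torus.convect (velDiff v i t) (velDiff v i t) x -
          FunctionSpaces.Torus.gradient (sqThird (velDiff v i) t) x) := by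
      rw [hSt, Torus.tensorDivergence_add_apply h1R h1T, Torus.tensorDivergence_const_smul_apply (hRA.isContDiff (by simp)),
        Torus.tensorDivergence_const_smul_apply (hw.tracelessSq.isContDiff (by simp)),
        Torus.tensorDivergence_antidivergence (by simp) hw, h.integral_velDiff hi ht, sub_zero,
        Torus.tensorDivergence_tracelessSq hw hwdiv]
      rfl
    have eW : velDiff v i t x = v i t x - v (i + 1) t x := rfl
    rw [h.timeDerivWithin_gluedVel hin ht htT x, eConv, eGrad, eDiv, eConvW, eW]
    -- linear algebra
    set DA := FunctionSpaces.Torus.timeDerivWithin (Icc (max ((i : ℝ) * τ - τ) 0) (min ((i : ℝ) * τ + τ) T)) (v i) t x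
    set DB := FunctionSpaces.Torus.timeDerivWithin
      (Icc (max (((i + 1 : ℕ) : ℝ) * τ - τ) 0) (min (((i + 1 : ℕ) : ℝ) * τ + τ) T)) (v (i + 1)) t x
    set CAA := FunctionSpaces.Torus.convect (v i t) (v i t) x
    set CAB := FunctionSpaces.Torus.convect (v i t) (v (i + 1) t) x
    set CBA := FunctionSpaces.Torus.convect (v (i + 1) t) (v i t) x
    set CBB := FunctionSpaces.Torus.convect (v (i + 1) t) (v (i + 1) t) x
    set GA := FunctionSpaces.Torus.gradient (p i t) x
    set GB := FunctionSpaces.Torus.gradient (p (i + 1) t) x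
    set GQ := FunctionSpaces.Torus.gradient (sqThird (velDiff v i) t) x
    set A := v i t x
    set B := v (i + 1) t x
    -- `hA : DA + CAA + GA = 0`, `hB : DB + CBB + GB = 0`
    have key : c' • A + c • DA + (-c' • B + (1 - c) • DB) +
        (c • (c • CAA + (1 - c) • CAB) + (1 - c) • (c • CBA + (1 - c) • CBB)) +
        (c • GA + ((1 - c) • GB + (c * (1 - c)) • GQ)) -
        (c' • (A - B) + (-(c * (1 - c))) • (CAA + (-1 : ℝ) • CAB + (-1 : ℝ) • (CBA + (-1 : ℝ) • CBB) - GQ)) =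
        c • (DA + CAA + GA) + (1 - c) • (DB + CBB + GB) := by
      module
    rw [hA, hB, smul_zero, smul_zero, add_zero, sub_eq_zero] at key
    exact key
  · -- the last interval: `v̄ = vₙ`, `p̄ = pₙ`, `R̊̄ = 0`
    have hV : gluedVel τ i v t = v i t := funext fun y => h.gluedVel_apply_last ht y
    have hPr : gluedPres τ i v p t = p i t := by
      funext y
      rw [h.gluedPres_apply le_rfl ht y, upperStep_of_le le_rfl, stepWeight_of_le le_rfl]
      ring
    have hSt : gluedStress τ i v t = fun _ _ => (0 : ℝ³) := by
      funext y j
      rw [h.gluedStress_apply ht y j, if_neg (lt_irrefl _)]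
    have hD : FunctionSpaces.Torus.timeDerivWithin (Icc 0 T) (gluedVel τ i v) t x =
        FunctionSpaces.Torus.timeDerivWithin (Icc (max ((i : ℝ) * τ - τ) 0) (min ((i : ℝ) * τ + τ) T)) (v i) t x := by
      rw [h.timeDerivWithin_gluedVel le_rfl ht htT x, upperStep_of_le le_rfl, stepDeriv_of_le le_rfl]
      simp
    rw [hD, hV, hPr, hSt, hA]
    simp

/-- **The glued triple is an Euler–Reynolds triple on `[0,T] × T³`** (BDSV §4.2, the three
bullets: `R̊̄_q` is a smooth symmetric traceless 2-tensor and `(v̄_q, p̄_q, R̊̄_q)` solves (2.2) on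
`T³ × [0,T]`). [cite: BuckmasterEtAl2018, §4.2] -/
theorem IsGlueFamily.isEulerReynoldsOn_glued :
    Torus.IsEulerReynoldsOn (Icc 0 T) (gluedVel τ n v) (gluedPres τ n v p) (gluedStress τ n v) where
  smooth_velocity := h.smooth_gluedVel
  smooth_pressure := h.smooth_gluedPres
  smooth_stress := h.smooth_gluedStress
  momentum t ht x := by
    obtain ⟨i, hin, hti⟩ := h.exists_anchor ht
    exact h.momentum hin hti ht x
  divFree t ht := by
    obtain ⟨i, hin, hti⟩ := h.exists_anchor ht
    have hsi := h.mem_span hti ht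
    have hvA : FunctionSpaces.Torus.IsSmooth (v i t) := (h.smooth_v hin).isSmooth_slice hsi
    have hdA : FunctionSpaces.Torus.IsDivFree (v i t) :=
      (h.exact i (h.anchor_le hin)).divFree t (by rwa [glueInterval_eq_Icc])
    rcases lt_or_eq_of_le hin with hi | rfl
    · have hsi' := h.mem_span_succ hti ht
      have hvB : FunctionSpaces.Torus.IsSmooth (v (i + 1) t) := (h.smooth_v (Nat.succ_le_of_lt hi)).isSmooth_slice hsi'
      have hdB : FunctionSpaces.Torus.IsDivFree (v (i + 1) t) :=
        (h.exact (i + 1) (h.anchor_le (Nat.succ_le_of_lt hi))).divFree t (by rwa [glueInterval_eq_Icc])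
      have hV : gluedVel τ n v t = fun y => upperStep τ n i t • v i t y + (1 - upperStep τ n i t) • v (i + 1) t y :=
        funext fun y => h.gluedVel_apply hin hti y
      rw [hV]
      exact IsDivFree.add ((hvA.smul _).isContDiff (by simp)) ((hvB.smul _).isContDiff (by simp))
        (Torus.isDivFree_const_smul (hvA.isContDiff (by simp)) hdA _) (Torus.isDivFree_const_smul (hvB.isContDiff (by simp)) hdB _)
    · have hV : gluedVel τ i v t = v i t := funext fun y => h.gluedVel_apply_last hti y
      rw [hV]
      exact hdA
  symm t ht x j k := by
    obtain ⟨i, hin, hti⟩ := h.exists_anchor ht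
    rw [h.gluedStress_apply hti, h.gluedStress_apply hti]
    split_ifs with hi
    · have hsi := h.mem_span hti ht
      have hsi' := h.mem_span_succ hti ht
      have hw : FunctionSpaces.Torus.IsSmooth (velDiff v i t) :=
        ((h.smooth_v hin).isSmooth_slice hsi).sub ((h.smooth_v (Nat.succ_le_of_lt hi)).isSmooth_slice hsi')
      simp only [PiLp.sub_apply, PiLp.smul_apply, smul_eq_mul]
      rw [Torus.antidivergence_symm hw x j k, Torus.tracelessSq_symm (velDiff v i t) x j k]
    · rfl
  traceFree t ht x := by
    obtain ⟨i, hin, hti⟩ := h.exists_anchor ht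
    simp_rw [h.gluedStress_apply hti]
    split_ifs with hi
    · have hsi := h.mem_span hti ht
      have hsi' := h.mem_span_succ hti ht
      have hw : FunctionSpaces.Torus.IsSmooth (velDiff v i t) :=
        ((h.smooth_v hin).isSmooth_slice hsi).sub ((h.smooth_v (Nat.succ_le_of_lt hi)).isSmooth_slice hsi')
      simp only [PiLp.sub_apply, PiLp.smul_apply, smul_eq_mul, Finset.sum_sub_distrib, ← Finset.mul_sum,
        Torus.antidivergence_trace (by simp) hw x, Torus.tracelessSq_traceFree (by simp) (velDiff v i t) x]
      ring
    · simp
  hasZeroMean_pressure t ht := by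
    obtain ⟨i, hin, hti⟩ := h.exists_anchor ht
    have hsi := h.mem_span hti ht
    have hpA : FunctionSpaces.Torus.IsSmooth (p i t) := (h.smooth_p hin).isSmooth_slice hsi
    have zA : FunctionSpaces.Torus.HasZeroMean (p i t) :=
      (h.exact i (h.anchor_le hin)).hasZeroMean_pressure t (by rwa [glueInterval_eq_Icc])
    rcases lt_or_eq_of_le hin with hi | rfl
    · have hsi' := h.mem_span_succ hti ht
      have hvA : FunctionSpaces.Torus.IsSmooth (v i t) := (h.smooth_v hin).isSmooth_slice hsi
      have hvB : FunctionSpaces.Torus.IsSmooth (v (i + 1) t) := (h.smooth_v (Nat.succ_le_of_lt hi)).isSmooth_slice hsi'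
      have hpB : FunctionSpaces.Torus.IsSmooth (p (i + 1) t) := (h.smooth_p (Nat.succ_le_of_lt hi)).isSmooth_slice hsi'
      have zB : FunctionSpaces.Torus.HasZeroMean (p (i + 1) t) :=
        (h.exact (i + 1) (h.anchor_le (Nat.succ_le_of_lt hi))).hasZeroMean_pressure t (by rwa [glueInterval_eq_Icc])
      have hq : FunctionSpaces.Torus.IsSmooth (sqThird (velDiff v i) t) := by
        have := (hvA.sub hvB).norm_sq.div_const (Fintype.card (Fin 3) : ℝ)
        exact this
      have hPr : gluedPres τ n v p t = fun y => upperStep τ n i t • p i t y + ((1 - upperStep τ n i t) • p (i + 1) t y +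
          stepWeight τ n i t • (sqThird (velDiff v i) t y - ∫ z, sqThird (velDiff v i) t z)) := by
        funext y
        rw [h.gluedPres_apply hin hti y]
        simp only [smul_eq_mul]
        ring
      rw [hPr]
      have z1 : FunctionSpaces.Torus.HasZeroMean (fun y => upperStep τ n i t • p i t y) := Torus.hasZeroMean_const_smul zA _
      have z2 : FunctionSpaces.Torus.HasZeroMean (fun y => (1 - upperStep τ n i t) • p (i + 1) t y) := Torus.hasZeroMean_const_smul zB _
      have z3 : FunctionSpaces.Torus.HasZeroMean (fun y => stepWeight τ n i t •
          (sqThird (velDiff v i) t y - ∫ z, sqThird (velDiff v i) t z)) :=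
        Torus.hasZeroMean_const_smul (Torus.hasZeroMean_sub_integral hq.integrable) _
      have i1 : Integrable (fun y => upperStep τ n i t • p i t y) volume := (hpA.smul _).integrable
      have i2 : Integrable (fun y => (1 - upperStep τ n i t) • p (i + 1) t y) volume := (hpB.smul _).integrable
      have i3 : Integrable (fun y => stepWeight τ n i t •
          (sqThird (velDiff v i) t y - ∫ z, sqThird (velDiff v i) t z)) volume := ((hq.sub (isSmooth_const _)).smul _).integrable
      exact HasZeroMean.add z1 (HasZeroMean.add z2 z3 i2 i3) i1 (i2.add i3)
    · have hPr : gluedPres τ i v p t = p i t := by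
        funext y
        rw [h.gluedPres_apply le_rfl hti y, upperStep_of_le le_rfl, stepWeight_of_le le_rfl]
        ring
      rw [hPr]
      exact zA

/-- **The support property (2.17)**: the glued stress vanishes at every time of `[0,T]` outside
`⋃ₘ [t_m + τ/3, t_m + 2τ/3]` (`θ_i' = θ_i(1-θ_i) = 0` there). [cite: BuckmasterEtAl2018, §2.5 (2.17) and §4.2] -/
theorem IsGlueFamily.supportedOnGlueIntervals_gluedStress : SupportedOnGlueIntervals T τ (gluedStress τ n v) := by
  intro t ht hnot x
  obtain ⟨i, hin, hti⟩ := h.exists_anchor ht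
  funext j
  rw [h.gluedStress_apply hti x j]
  split_ifs with hi
  · have hout : t ≤ (i : ℝ) * τ + τ / 3 ∨ (i : ℝ) * τ + 2 * τ / 3 ≤ t := by
      by_contra hc
      push Not at hc
      exact hnot i ⟨by linarith [hc.1], by linarith [hc.2]⟩
    have e : upperStep τ n i = glueStep τ (i * τ) := funext fun s => upperStep_of_lt hi τ s
    have h1 : stepDeriv τ n i t = 0 := by
      unfold stepDeriv
      rw [e]
      exact deriv_glueStep_eq_zero h.hτ hout
    have h2 : stepWeight τ n i t = 0 := by
      unfold stepWeight
      rw [upperStep_of_lt hi]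
      exact glueStep_mul_one_sub_eq_zero h.hτ hout
    rw [h1, h2, zero_smul, zero_smul, sub_zero]
    rfl
  · rfl

end EulerReynolds

end Family

end BDSV

end Literature.Analysis.FluidPDE
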